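import Summits.AtomisticToContinuum.FouriersLaw.Theorems.ParityLiouvilleSeedWindowLimitDefs
import Literature.MathematicalPhysics.KineticTheory.ChainReflection

/-!
# Finite-`N` bookkeeping for the soft extraction (helper for `stub_softExtraction`)

Helper file for stub `stub_softExtraction` (S2c) of the birth line of crux `LocalOhmBV.LocalOhm`
(item stmt-AtomisticToContinuum-12009). At a fixed chain length `N` the extraction uses the
first-order response quotients `δ ↦ (μ_{N,T+δ/2,T-δ/2}(ψ) - μ_{N,T,T}(ψ)) / δ` of a two-temperature
family of states. This file records the soft facts about them that the extraction needs:

* `eventually_integrable_of_tendsto_quotient`, `eventually_integrable_ness` — if the response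
  quotient of every continuous polynomially bounded observable converges, such observables are
  integrable under the perturbed states for small `δ ≠ 0` (test the quotient of `|ψ| + 1`);
* `tendsto_quotient_linear`, `limUnder_quotient_linear` — linearity of the response limit;
* `tendsto_quotient_bondCurrent` — with equal mean bulk bond currents and no boundary bond current,
  the response of a single bulk bond current is `d / (N - 1)`, `d` the response of the total current;
* `limUnder_quotient_eq_zero` — an observable with zero mean in every state of the family has zero
  response;
* window embedding bookkeeping: `norm_boxRestrictAt_embed_le_norm`, `boxRestrictAt_embed_eq_of_agree`
  (a transported box observable only depends on the window coordinates).

(The last-site bond current `OscillatorChain.bondCurrent_eq_zero_of_last` and the embedded bond current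
`WindowLimit.bondCurrentZ_embed` are taken from the tree.)
-/

set_option autoImplicit false

noncomputable section

namespace Summit.AtomisticToContinuum.FouriersLaw.Theorems.LocalOhmBirth.SoftExtraction

open MeasureTheory Filter Topology
open scoped BigOperators
open Literature.MathematicalPhysics.KineticTheory.HeatConduction
open Summit.AtomisticToContinuum.FouriersLaw.Theorems.WindowLimit (embed embed_apply_of
  embed_apply_of_not)

/-! ### Eventual integrability under the perturbed states -/

/-- If the response quotient of an observable `φ ≥ 1`, integrable under the reference probability
measure `ν₀`, converges as `δ → 0` (`δ ≠ 0`), then `φ` is integrable under `ν δ` for all small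
`δ ≠ 0` (otherwise its Bochner integral would vanish while it tends to `∫ φ dν₀ ≥ 1`). [folklore] -/
theorem eventually_integrable_of_tendsto_quotient {X : Type*} [MeasurableSpace X]
    (ν : ℝ → Measure X) (ν₀ : Measure X) [IsProbabilityMeasure ν₀] {φ : X → ℝ}
    (hφ1 : ∀ z, 1 ≤ φ z) (hint : Integrable φ ν₀) {ρ : ℝ}
    (h : Tendsto (fun δ : ℝ => ((∫ z, φ z ∂ν δ) - ∫ z, φ z ∂ν₀) / δ) (𝓝[≠] 0) (𝓝 ρ)) :
    ∀ᶠ δ in 𝓝[≠] (0 : ℝ), Integrable φ (ν δ) := by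
  have hδ : Tendsto (fun δ : ℝ => δ) (𝓝[≠] (0 : ℝ)) (𝓝 0) :=
    tendsto_id.mono_left nhdsWithin_le_nhds
  have h1 := h.mul hδ
  rw [mul_zero] at h1
  have h2 : Tendsto (fun δ : ℝ => (∫ z, φ z ∂ν δ) - ∫ z, φ z ∂ν₀) (𝓝[≠] 0) (𝓝 0) := by
    refine h1.congr' ?_
    filter_upwards [self_mem_nhdsWithin] with δ hδ0
    exact div_mul_cancel₀ _ hδ0
  have h3 : Tendsto (fun δ : ℝ => ∫ z, φ z ∂ν δ) (𝓝[≠] 0) (𝓝 (∫ z, φ z ∂ν₀)) := by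
    have := h2.add_const (∫ z, φ z ∂ν₀)
    simpa only [sub_add_cancel, zero_add] using this
  have hge : (1 : ℝ) ≤ ∫ z, φ z ∂ν₀ := by
    have := integral_mono (integrable_const (1 : ℝ)) hint hφ1
    simpa using this
  have hev : ∀ᶠ δ in 𝓝[≠] (0 : ℝ), (1 / 2 : ℝ) < ∫ z, φ z ∂ν δ :=
    h3.eventually (lt_mem_nhds (by linarith))
  filter_upwards [hev] with δ hδ'
  exact Integrable.of_integral_ne_zero fun h0 => by rw [h0] at hδ'; linarith

/-- Domination: `|ψ| ≤ φ` with `φ` integrable and `ψ` a.e.-strongly measurable gives `ψ`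
integrable. [folklore] -/
theorem integrable_of_abs_le_of_integrable {X : Type*} [MeasurableSpace X] {ν : Measure X}
    {ψ φ : X → ℝ} (hψm : AEStronglyMeasurable ψ ν) (hφ : Integrable φ ν) (h : ∀ z, |ψ z| ≤ φ z) :
    Integrable ψ ν :=
  hφ.mono' hψm (Eventually.of_forall fun z => by rw [Real.norm_eq_abs]; exact h z)

/-- **Eventual integrability under the two-temperature family.** If the response quotient of every
continuous polynomially bounded observable of the `N`-chain converges and such observables are
integrable under the (probability) reference state `μN T T`, then every continuous polynomially
bounded `ψ` is integrable under `μN (T + δ/2) (T - δ/2)` for all small `δ ≠ 0`. [folklore] -/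
theorem eventually_integrable_ness {N : ℕ} (μN : ℝ → ℝ → Measure (PhaseSpace N)) (T : ℝ)
    [IsProbabilityMeasure (μN T T)]
    (hresp : ∀ ψ : PhaseSpace N → ℝ, Continuous ψ →
      (∃ (C₀ : ℝ) (m : ℕ), ∀ z, |ψ z| ≤ C₀ * (1 + ‖z‖) ^ m) →
      ∃ ρ : ℝ, Tendsto (fun δ : ℝ => ((∫ z, ψ z ∂(μN (T + δ / 2) (T - δ / 2))) -
        ∫ z, ψ z ∂(μN T T)) / δ) (𝓝[≠] 0) (𝓝 ρ))
    (hint : ∀ ψ : PhaseSpace N → ℝ, Continuous ψ →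
      (∃ (C₀ : ℝ) (m : ℕ), ∀ z, |ψ z| ≤ C₀ * (1 + ‖z‖) ^ m) → Integrable ψ (μN T T))
    {ψ : PhaseSpace N → ℝ} (hψ : Continuous ψ)
    (hb : ∃ (C₀ : ℝ) (m : ℕ), ∀ z, |ψ z| ≤ C₀ * (1 + ‖z‖) ^ m) :
    ∀ᶠ δ in 𝓝[≠] (0 : ℝ), Integrable ψ (μN (T + δ / 2) (T - δ / 2)) := by
  obtain ⟨C₀, m, hC⟩ := hb
  have hφc : Continuous fun z : PhaseSpace N => |ψ z| + 1 :=
    (continuous_abs.comp hψ).add continuous_const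
  have hφb : ∃ (C₁ : ℝ) (m₁ : ℕ), ∀ z : PhaseSpace N, |(|ψ z| + 1)| ≤ C₁ * (1 + ‖z‖) ^ m₁ := by
    refine ⟨C₀ + 1, m, fun z => ?_⟩
    have h1 : (1 : ℝ) ≤ (1 + ‖z‖) ^ m := one_le_pow₀ (by linarith [norm_nonneg z])
    rw [abs_of_nonneg (by positivity)]
    calc |ψ z| + 1 ≤ C₀ * (1 + ‖z‖) ^ m + (1 + ‖z‖) ^ m := add_le_add (hC z) h1
      _ = (C₀ + 1) * (1 + ‖z‖) ^ m := by ring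
  obtain ⟨ρ, hρ⟩ := hresp _ hφc hφb
  have hφ1 : ∀ z : PhaseSpace N, 1 ≤ |ψ z| + 1 := fun z => by linarith [abs_nonneg (ψ z)]
  have hev := eventually_integrable_of_tendsto_quotient (fun δ => μN (T + δ / 2) (T - δ / 2))
    (μN T T) hφ1 (hint _ hφc hφb) hρ
  filter_upwards [hev] with δ hδ
  exact integrable_of_abs_le_of_integrable hψ.aestronglyMeasurable hδ fun z => by linarith

/-! ### Linearity and special values of the response limit -/

/-- Linearity of the response quotient limit (given eventual integrability). [folklore] -/
theorem tendsto_quotient_linear {X : Type*} [MeasurableSpace X] (ν : ℝ → Measure X) (ν₀ : Measure X)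
    {ψ₁ ψ₂ : X → ℝ} (c₁ c₂ : ℝ) {ρ₁ ρ₂ : ℝ}
    (h₁ : Tendsto (fun δ : ℝ => ((∫ z, ψ₁ z ∂ν δ) - ∫ z, ψ₁ z ∂ν₀) / δ) (𝓝[≠] 0) (𝓝 ρ₁))
    (h₂ : Tendsto (fun δ : ℝ => ((∫ z, ψ₂ z ∂ν δ) - ∫ z, ψ₂ z ∂ν₀) / δ) (𝓝[≠] 0) (𝓝 ρ₂))
    (hi₁ : ∀ᶠ δ in 𝓝[≠] (0 : ℝ), Integrable ψ₁ (ν δ))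
    (hi₂ : ∀ᶠ δ in 𝓝[≠] (0 : ℝ), Integrable ψ₂ (ν δ))
    (hi₁' : Integrable ψ₁ ν₀) (hi₂' : Integrable ψ₂ ν₀) :
    Tendsto (fun δ : ℝ => ((∫ z, (c₁ * ψ₁ z + c₂ * ψ₂ z) ∂ν δ) -
      ∫ z, (c₁ * ψ₁ z + c₂ * ψ₂ z) ∂ν₀) / δ) (𝓝[≠] 0) (𝓝 (c₁ * ρ₁ + c₂ * ρ₂)) := by
  refine ((h₁.const_mul c₁).add (h₂.const_mul c₂)).congr' ?_
  filter_upwards [hi₁, hi₂] with δ hδ₁ hδ₂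
  rw [integral_add (hδ₁.const_mul c₁) (hδ₂.const_mul c₂),
    integral_add (hi₁'.const_mul c₁) (hi₂'.const_mul c₂), integral_const_mul, integral_const_mul,
    integral_const_mul, integral_const_mul]
  ring

/-- **Linearity of the response limit** `ρ(ψ) = lim_{δ → 0, δ ≠ 0}` of the response quotient, as a
`limUnder`, on continuous polynomially bounded observables of the `N`-chain. [folklore] -/
theorem limUnder_quotient_linear {N : ℕ} (μN : ℝ → ℝ → Measure (PhaseSpace N)) (T : ℝ)
    [IsProbabilityMeasure (μN T T)]
    (hresp : ∀ ψ : PhaseSpace N → ℝ, Continuous ψ →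
      (∃ (C₀ : ℝ) (m : ℕ), ∀ z, |ψ z| ≤ C₀ * (1 + ‖z‖) ^ m) →
      ∃ ρ : ℝ, Tendsto (fun δ : ℝ => ((∫ z, ψ z ∂(μN (T + δ / 2) (T - δ / 2))) -
        ∫ z, ψ z ∂(μN T T)) / δ) (𝓝[≠] 0) (𝓝 ρ))
    (hint : ∀ ψ : PhaseSpace N → ℝ, Continuous ψ →
      (∃ (C₀ : ℝ) (m : ℕ), ∀ z, |ψ z| ≤ C₀ * (1 + ‖z‖) ^ m) → Integrable ψ (μN T T))
    {ψ₁ ψ₂ : PhaseSpace N → ℝ} (hψ₁ : Continuous ψ₁) (hψ₂ : Continuous ψ₂)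
    (hb₁ : ∃ (C₀ : ℝ) (m : ℕ), ∀ z, |ψ₁ z| ≤ C₀ * (1 + ‖z‖) ^ m)
    (hb₂ : ∃ (C₀ : ℝ) (m : ℕ), ∀ z, |ψ₂ z| ≤ C₀ * (1 + ‖z‖) ^ m) (c₁ c₂ : ℝ) :
    limUnder (𝓝[≠] (0 : ℝ)) (fun δ : ℝ =>
        ((∫ z, (c₁ * ψ₁ z + c₂ * ψ₂ z) ∂(μN (T + δ / 2) (T - δ / 2))) -
          ∫ z, (c₁ * ψ₁ z + c₂ * ψ₂ z) ∂(μN T T)) / δ) =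
      c₁ * limUnder (𝓝[≠] (0 : ℝ)) (fun δ : ℝ =>
        ((∫ z, ψ₁ z ∂(μN (T + δ / 2) (T - δ / 2))) - ∫ z, ψ₁ z ∂(μN T T)) / δ) +
      c₂ * limUnder (𝓝[≠] (0 : ℝ)) (fun δ : ℝ =>
        ((∫ z, ψ₂ z ∂(μN (T + δ / 2) (T - δ / 2))) - ∫ z, ψ₂ z ∂(μN T T)) / δ) := by
  obtain ⟨ρ₁, h₁⟩ := hresp ψ₁ hψ₁ hb₁
  obtain ⟨ρ₂, h₂⟩ := hresp ψ₂ hψ₂ hb₂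
  have hi₁ := eventually_integrable_ness μN T hresp hint hψ₁ hb₁
  have hi₂ := eventually_integrable_ness μN T hresp hint hψ₂ hb₂
  have h := tendsto_quotient_linear (fun δ => μN (T + δ / 2) (T - δ / 2)) (μN T T) c₁ c₂ h₁ h₂
    hi₁ hi₂ (hint ψ₁ hψ₁ hb₁) (hint ψ₂ hψ₂ hb₂)
  rw [h₁.limUnder_eq, h₂.limUnder_eq]
  exact h.limUnder_eq

/-- An observable whose mean vanishes in every state `μN T_L T_R` (`T_L, T_R > 0`) of the family has
zero response limit at `T > 0`. [folklore] -/
theorem limUnder_quotient_eq_zero {N : ℕ} (μN : ℝ → ℝ → Measure (PhaseSpace N)) {T : ℝ}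
    (hT : 0 < T) (F : ChainConfig → ℝ) (c : ℕ)
    (hF : ∀ T_L T_R : ℝ, 0 < T_L → 0 < T_R → ∫ z, F (embed N c z) ∂(μN T_L T_R) = 0) :
    limUnder (𝓝[≠] (0 : ℝ)) (fun δ : ℝ =>
      ((∫ z, F (embed N c z) ∂(μN (T + δ / 2) (T - δ / 2))) - ∫ z, F (embed N c z) ∂(μN T T)) / δ) =
      0 := by
  refine Filter.Tendsto.limUnder_eq ?_
  refine tendsto_const_nhds.congr' ?_
  have hI : Set.Ioo (-(2 * T)) (2 * T) ∈ 𝓝 (0 : ℝ) := Ioo_mem_nhds (by linarith) (by linarith)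
  filter_upwards [mem_nhdsWithin_of_mem_nhds hI] with δ hδ
  rw [hF _ _ (by linarith [hδ.1]) (by linarith [hδ.2]), hF _ _ hT hT, sub_zero, zero_div]

/-! ### Bond currents: the total current, the single-bond response -/

/-- If all genuine bond currents (bonds `(i, i+1)`, `i + 2 ≤ N`) have the same mean `J`, the total
current is `(N - 1) J`. [folklore] -/
theorem totalCurrent_eq_mul_of_bulk (P : OscillatorChain) {N : ℕ} (ν : Measure (PhaseSpace N))
    (x : Fin N) (J : ℝ) (h : ∀ i : Fin N, i.val + 2 ≤ N → ∫ z, P.bondCurrent N i z ∂ν = J) :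
    P.totalCurrent ν = ((N : ℝ) - 1) * J := by
  unfold OscillatorChain.totalCurrent
  obtain ⟨M, rfl⟩ : ∃ M, N = M + 1 := ⟨N - 1, by have := x.isLt; omega⟩
  rw [Fin.sum_univ_castSucc]
  have hlast : ∫ z, P.bondCurrent (M + 1) (Fin.last M) z ∂ν = 0 := by
    simp [P.bondCurrent_eq_zero_of_last (M + 1) (Fin.last M) (by simp)]
  rw [hlast, add_zero, Finset.sum_congr rfl fun (i : Fin M) _ => h (Fin.castSucc i)
    (by rw [Fin.val_castSucc]; have := i.isLt; omega)]
  simp only [Finset.sum_const, Finset.card_univ, Fintype.card_fin, nsmul_eq_mul, Nat.cast_add,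
    Nat.cast_one]
  ring

/-- **Single-bond current response.** If the total current of `μN (T+δ/2) (T-δ/2)` has response `d`,
all genuine bond currents have equal means in every state of the family, and the bond current has
zero mean in the reference state, then the response of one bulk bond current is `d / (N - 1)`.
[folklore] -/
theorem tendsto_quotient_bondCurrent :
    ∀ (P : OscillatorChain) {N : ℕ} (μN : ℝ → ℝ → Measure (PhaseSpace N)) (T d : ℝ), 0 < T →
    ∀ x : Fin N, x.val + 2 ≤ N →
    Tendsto (fun δ : ℝ => P.totalCurrent (μN (T + δ / 2) (T - δ / 2)) / δ) (𝓝[≠] 0) (𝓝 d) →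
    (∀ (T_L T_R : ℝ), 0 < T_L → 0 < T_R → ∀ i k : Fin N, i.val + 2 ≤ N → k.val + 2 ≤ N →
      ∫ z, P.bondCurrent N i z ∂(μN T_L T_R) = ∫ z, P.bondCurrent N k z ∂(μN T_L T_R)) →
    ∫ z, P.bondCurrent N x z ∂(μN T T) = 0 →
    Tendsto (fun δ : ℝ => ((∫ z, P.bondCurrent N x z ∂(μN (T + δ / 2) (T - δ / 2))) -
      ∫ z, P.bondCurrent N x z ∂(μN T T)) / δ) (𝓝[≠] 0) (𝓝 (d / ((N : ℝ) - 1))) := by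
  intro P N μN T d hT x hx hD ha4 h0
  have hN : (1 : ℝ) < N := by
    have := x.isLt
    exact_mod_cast (by omega : 1 < N)
  have hN1 : (N : ℝ) - 1 ≠ 0 := by linarith
  have hI : Set.Ioo (-(2 * T)) (2 * T) ∈ 𝓝 (0 : ℝ) := Ioo_mem_nhds (by linarith) (by linarith)
  refine (hD.div_const ((N : ℝ) - 1)).congr' ?_
  filter_upwards [mem_nhdsWithin_of_mem_nhds hI] with δ hδ
  have hL : 0 < T + δ / 2 := by linarith [hδ.1]
  have hR : 0 < T - δ / 2 := by linarith [hδ.2]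
  have htot := totalCurrent_eq_mul_of_bulk P (μN (T + δ / 2) (T - δ / 2)) x
    (∫ z, P.bondCurrent N x z ∂(μN (T + δ / 2) (T - δ / 2))) (fun i hi => ha4 _ _ hL hR i x hi hx)
  rw [htot, h0, sub_zero, mul_div_assoc, mul_div_cancel_left₀ _ hN1]

/-! ### Window embedding bookkeeping -/

/-- The box restriction of an embedded configuration is norm-bounded by the phase-space point
(no hypothesis on the position of the box: outside the chain the embedding reads `(0, 0)`).
[folklore] -/
theorem norm_boxRestrictAt_embed_le_norm {N c : ℕ} (a : ℤ) (n : ℕ) (z : PhaseSpace N) :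
    ‖boxRestrictAt a n (embed N c z)‖ ≤ ‖z‖ := by
  refine (pi_norm_le_iff_of_nonneg (norm_nonneg z)).2 fun i => ?_
  rw [boxRestrictAt_apply]
  by_cases h : 0 ≤ (a + (i : ℕ)) + c ∧ (a + (i : ℕ)) + c < N
  · rw [embed_apply_of N c z h, Prod.norm_def]
    exact max_le ((norm_le_pi_norm z.1 _).trans (norm_fst_le z))
      ((norm_le_pi_norm z.2 _).trans (norm_snd_le z))
  · rw [embed_apply_of_not N c z h]
    simp

/-- A polynomial bound of a box profile passes to the transported observable. [folklore] -/
theorem polyBound_comp_boxRestrictAt_embed {N c : ℕ} (a : ℤ) (n : ℕ) {g : (Fin (n + 1) → ℝ × ℝ) → ℝ}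
    {C₀ : ℝ} {m : ℕ} (hg : ∀ y, |g y| ≤ C₀ * (1 + ‖y‖) ^ m) (z : PhaseSpace N) :
    |g (boxRestrictAt a n (embed N c z))| ≤ C₀ * (1 + ‖z‖) ^ m := by
  have hC : 0 ≤ C₀ := by
    by_contra hC
    have h1 : 0 < (1 + ‖(0 : Fin (n + 1) → ℝ × ℝ)‖) ^ m := by positivity
    have := (abs_nonneg _).trans (hg 0)
    nlinarith
  refine (hg _).trans (mul_le_mul_of_nonneg_left ?_ hC)
  exact pow_le_pow_left₀ (by positivity)
    (by linarith [norm_boxRestrictAt_embed_le_norm (N := N) (c := c) a n z]) m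

/-- The transported box observable is continuous if its profile is. [folklore] -/
theorem continuous_comp_boxRestrictAt_embed {N c : ℕ} (a : ℤ) (n : ℕ) {g : (Fin (n + 1) → ℝ × ℝ) → ℝ}
    (hg : Continuous g) : Continuous fun z : PhaseSpace N => g (boxRestrictAt a n (embed N c z)) :=
  hg.comp ((continuous_pi fun _ => continuous_apply _).comp
    (Summit.AtomisticToContinuum.FouriersLaw.Theorems.WindowLimit.continuous_embed N c))

/-- **Window dependence.** A box observable transported by `embed N c` only depends on the window
coordinates: if two phase-space points agree at all sites `i` with `x - ℓ ≤ i ≤ x + ℓ + 1` and the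
finite box `a + c, …, a + c + n` lies in that window, the transported values agree. [folklore] -/
theorem boxRestrictAt_embed_eq_of_agree {N c : ℕ} {a : ℤ} {n : ℕ} (x ℓ : ℕ)
    (hlo : (x : ℤ) ≤ a + c + ℓ) (hhi : a + c + n ≤ (x : ℤ) + ℓ + 1) (z z' : PhaseSpace N)
    (h : ∀ i : Fin N, x ≤ i.val + ℓ → i.val ≤ x + ℓ + 1 → z.1 i = z'.1 i ∧ z.2 i = z'.2 i) :
    boxRestrictAt a n (embed N c z) = boxRestrictAt a n (embed N c z') := by
  funext i
  have hi := i.isLt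
  rw [boxRestrictAt_apply, boxRestrictAt_apply]
  by_cases hr : 0 ≤ (a + (i : ℕ)) + c ∧ (a + (i : ℕ)) + c < N
  · rw [embed_apply_of N c z hr, embed_apply_of N c z' hr]
    obtain ⟨h1, h2⟩ := h ⟨((a + (i : ℕ)) + c).toNat, by omega⟩ (by simp only; omega)
      (by simp only; omega)
    rw [h1, h2]
  · rw [embed_apply_of_not N c z hr, embed_apply_of_not N c z' hr]

end Summit.AtomisticToContinuum.FouriersLaw.Theorems.LocalOhmBirth.SoftExtraction

end
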